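import Mathlib
import Literature.NumberTheory.Transcendental.KZLogCalculusProofs
import Literature.NumberTheory.Transcendental.KZDominatedFamilyRelations
import Literature.NumberTheory.Transcendental.SemialgebraicLineDeriv
import Literature.NumberTheory.Transcendental.KZSemialgebraicComplex
import Literature.NumberTheory.Transcendental.KZIntervalPeriodProofs
import Summits.KontsevichZagierPeriods.KontsevichZagierPeriods.Theorems.LiouvilleUnfoldingLogPrimitiveNL
import Summits.KontsevichZagierPeriods.KontsevichZagierPeriods.Theorems.LogPrimitiveNL.Negative.Defs

/-!
# `TateFamilyKernelCurves` (stmt-KontsevichZagierPeriods-9132), line `Sketch` — stub `stub_exactModulusPart`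

The exact + modulus part of a Hermite-reduced real rational integrand on `(0,1)` is a relation of
the Kontsevich–Zagier calculus: if `g = G′` on `(0,1)` with `G` `ℚ`-semialgebraic and continuous on
`[0,1]`, `G 1 = G 0`, and the modulus total `Σ hᵢ log(Vᵢ 1 / Vᵢ 0)` vanishes
(`Vᵢ t = (t − aᵢ)² + bᵢ² ≠ 0` on `[0,1]`, `aᵢ, bᵢ, hᵢ` real algebraic), then every honest
representation `r = [(0,1), g + Σ hᵢ Vᵢ′/Vᵢ]` satisfies `KZ.of r ∈ KZ.relations`.

Proof (plumbing of proved tree results, after the template `InverseLandauDlogLoopRelator`):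
pass to the closed band `B = [0,1] ⊂ ℝ¹` over the point with the indicator-extended integrand
(`R`; the two endpoints are null, rule 1a), split `R ≡ R_g + R_M` by integrand additivity
(`R_M = [B, Σ hᵢ Vᵢ′/Vᵢ]`, `R_g = [B, R.integrand − Σ hᵢ Vᵢ′/Vᵢ]`), close `R_g` by ONE Newton–Leibniz
move over the point (rule 3, `n = 0`, primitive `G`, base `[pt, G 1 − G 0] = [pt, 0]`) and `R_M` by
the proved logarithmic Newton–Leibniz rule
`Summit.KontsevichZagierPeriods.LiouvilleUnfolding.LogPrimitiveNL.LogPrimitiveNL_of` (`n = 0`,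
`k = m`, constant `hᵢ`, `Vᵢ = (t − aᵢ)² + bᵢ²`, base `[pt, Σ hᵢ (log Vᵢ 1 − log Vᵢ 0)] = [pt, 0]`).
-/

noncomputable section

open MeasureTheory Set
open Literature.NumberTheory.Transcendental
open Literature.ModelTheory.ExponentialFields (IsSemialgebraic isSemialgebraic_univ)
open Summit.KontsevichZagierPeriods.LiouvilleUnfolding.LogPrimitiveNL.Negative
  (snoc_fin_one_apply_zero isCompact_band1)

namespace Summit.KontsevichZagierPeriods.InverseLandau

/-- **S4 (exact + modulus part is a relation).** `[(0,1), g + Σᵢ hᵢ·2(t−aᵢ)/((t−aᵢ)²+bᵢ²)] ∈ relations`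
when `g = G′` with `G` semialgebraic, continuous on `[0,1]`, `G 1 = G 0`, and the modulus total
`Σ hᵢ log(Vᵢ 1 / Vᵢ 0)` vanishes: Newton–Leibniz over the point (rule 3, `n = 0`) for the exact part and
the proved logarithmic Newton–Leibniz rule `LogPrimitiveNL_of` (`n = 0`, `Vᵢ = (t−aᵢ)²+bᵢ²`) for the
modulus part, the two endpoints of `(0,1)` being null (rule 1a). [cite: KontsevichZagier2001, §1.2] -/
theorem stub_exactModulusPart : ∀ (G g : ℝ → ℝ) (m : ℕ) (a b h : Fin m → ℝ) (r : KZ.IntegralRep 1),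
    IsSemialgebraicFunOn ℚ {x : Fin 1 → ℝ | x 0 ∈ Set.Icc (0 : ℝ) 1} (fun x => G (x 0)) →
    ContinuousOn G (Set.Icc 0 1) → ContinuousOn g (Set.Icc 0 1) →
    (∀ t ∈ Set.Ioo (0 : ℝ) 1, HasDerivAt G (g t) t) → G 1 = G 0 →
    (∀ i, IsAlgebraic ℚ (a i) ∧ IsAlgebraic ℚ (b i) ∧ IsAlgebraic ℚ (h i)) →
    (∀ i, ∀ t ∈ Set.Icc (0 : ℝ) 1, (t - a i) ^ 2 + (b i) ^ 2 ≠ 0) →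
    ∑ i, h i * Real.log (((1 - a i) ^ 2 + (b i) ^ 2) / ((a i) ^ 2 + (b i) ^ 2)) = 0 →
    r.domain = {x | x 0 ∈ Set.Ioo (0 : ℝ) 1} →
    Set.EqOn r.integrand
      (fun x => g (x 0) + ∑ i, h i * (2 * (x 0 - a i)) / ((x 0 - a i) ^ 2 + (b i) ^ 2)) r.domain →
    KZ.of r ∈ KZ.relations := by
  intro G g m a b h r hGsa hGc _hgc hGd hG10 halg hV hmod hdom hint
  -- the base point `ℝ⁰` and the closed band `[0,1]`
  have hτ : IsSemialgebraic ℚ (univ : Set (Fin 0 → ℝ)) := isSemialgebraic_univ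
  have ha : IsSemialgebraicFunOn ℚ (univ : Set (Fin 0 → ℝ)) (fun _ => (0 : ℝ)) := by
    simpa using isSemialgebraicFunOn_ratCast hτ 0
  have hb : IsSemialgebraicFunOn ℚ (univ : Set (Fin 0 → ℝ)) (fun _ => (1 : ℝ)) := by
    simpa using isSemialgebraicFunOn_ratCast hτ 1
  set B : Set (Fin 1 → ℝ) := KZlog.band (univ : Set (Fin 0 → ℝ)) (fun _ => (0 : ℝ)) (fun _ => 1)
    with hB_def
  have hB : B = {x : Fin 1 → ℝ | x 0 ∈ Icc (0 : ℝ) 1} := by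
    ext z
    simp only [hB_def, KZlog.mem_band, mem_univ, true_and, mem_setOf_eq, mem_Icc, Fin.last_zero]
  have hBsa : IsSemialgebraic ℚ B := KZlog.isSemialgebraic_band ha hb
  have hBc : IsCompact B := isCompact_band1 0 1
  have hmemB : ∀ z : Fin 1 → ℝ, z ∈ B ↔ z 0 ∈ Icc (0 : ℝ) 1 := fun z => by rw [hB]; rfl
  have hmemr : ∀ z : Fin 1 → ℝ, z ∈ r.domain ↔ z 0 ∈ Ioo (0 : ℝ) 1 := fun z => by rw [hdom]; rfl
  have hr_sub : r.domain ⊆ B := fun z hz => (hmemB z).2 (Ioo_subset_Icc_self ((hmemr z).1 hz))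
  have hrm : MeasurableSet r.domain := KZ.IntegralRep.measurableSet_domain_holds r
  -- the endpoints are null
  have hnull : volume (B \ r.domain) = 0 := by
    have hcov : B \ r.domain ⊆ {z : Fin 1 → ℝ | z (Fin.last 0) = 0} ∪ {z | z (Fin.last 0) = 1} := by
      intro z hz
      have h1 : z 0 ∈ Icc (0 : ℝ) 1 := (hmemB z).1 hz.1
      have h2 : ¬ z 0 ∈ Ioo (0 : ℝ) 1 := fun h => hz.2 ((hmemr z).2 h)
      simp only [mem_union, mem_setOf_eq, Fin.last_zero]
      rcases h1.1.eq_or_lt with h0 | h0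
      · exact Or.inl h0.symm
      · exact Or.inr (le_antisymm h1.2 (not_lt.1 fun hlt => h2 ⟨h0, hlt⟩))
    exact measure_mono_null hcov
      (measure_union_null (KZ.volume_setOf_last_eq_zero 0) (KZ.volume_setOf_last_eq_zero 1))
  have hEsa : IsSemialgebraic ℚ (B \ r.domain) := hBsa.diff r.isSemialgebraic_domain
  -- `V i ≠ 0` on the closed band, and the algebraic constants
  have hV' : ∀ i, ∀ z ∈ B, (z 0 - a i) ^ 2 + (b i) ^ 2 ≠ 0 := fun i z hz => hV i (z 0) ((hmemB z).1 hz)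
  have hVpos : ∀ i, ∀ z ∈ B, 0 < (z 0 - a i) ^ 2 + (b i) ^ 2 := fun i z hz =>
    lt_of_le_of_ne (by positivity) (hV' i z hz).symm
  have hca : ∀ i, IsSemialgebraicFunOn ℚ B (fun _ => a i) := fun i =>
    isSemialgebraicFunOn_const_of_isAlgebraic hBsa (halg i).1
  have hcb : ∀ i, IsSemialgebraicFunOn ℚ B (fun _ => b i) := fun i =>
    isSemialgebraicFunOn_const_of_isAlgebraic hBsa (halg i).2.1
  have hch : ∀ i, IsSemialgebraicFunOn ℚ B (fun _ => h i) := fun i =>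
    isSemialgebraicFunOn_const_of_isAlgebraic hBsa (halg i).2.2
  have hx0 : IsSemialgebraicFunOn ℚ B (fun z : Fin 1 → ℝ => z 0) := isSemialgebraicFunOn_apply hBsa 0
  have hVsa : ∀ i, IsSemialgebraicFunOn ℚ B (fun z : Fin 1 → ℝ => (z 0 - a i) ^ 2 + (b i) ^ 2) :=
    fun i => ((hx0.fun_sub (hca i)).fun_pow 2).fun_add ((hcb i).fun_pow 2)
  have hterm_sa : ∀ i, IsSemialgebraicFunOn ℚ B
      (fun z : Fin 1 → ℝ => h i * (2 * (z 0 - a i)) / ((z 0 - a i) ^ 2 + (b i) ^ 2)) := fun i =>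
    ((hch i).fun_mul ((isSemialgebraicFunOn_const_ofNat hBsa 2).fun_mul (hx0.fun_sub (hca i)))).div
      (hVsa i) (hV' i)
  have hterm_c : ∀ i, ContinuousOn
      (fun z : Fin 1 → ℝ => h i * (2 * (z 0 - a i)) / ((z 0 - a i) ^ 2 + (b i) ^ 2)) B := fun i =>
    ContinuousOn.div (by fun_prop) (by fun_prop) (hV' i)
  -- the modulus integrand `M = Σ hᵢ Vᵢ′/Vᵢ`
  set M : (Fin 1 → ℝ) → ℝ := fun z => ∑ i, h i * (2 * (z 0 - a i)) / ((z 0 - a i) ^ 2 + (b i) ^ 2)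
    with hM_def
  have hM_sa : IsSemialgebraicFunOn ℚ B M :=
    IsSemialgebraicFunOn.fun_finsetSum _ hBsa fun i _ => hterm_sa i
  have hM_c : ContinuousOn M B := continuousOn_finsetSum _ fun i _ => hterm_c i
  have hM_int : IntegrableOn M B := hM_c.integrableOn_compact hBc
  -- the closed-band representation `R = [B, 𝟙_{(0,1)} f]`
  set f : (Fin 1 → ℝ) → ℝ := r.domain.indicator r.integrand with hf_def
  have hf_on : EqOn f r.integrand r.domain := fun z hz => indicator_of_mem hz _
  have hf_off : EqOn f (fun _ => (0 : ℝ)) (B \ r.domain) := fun z hz => indicator_of_notMem hz.2 _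
  have hf_sa : IsSemialgebraicFunOn ℚ B f := by
    have h := IsSemialgebraicFunOn.union r.isSemialgebraicFunOn_integrand
      (by simpa using isSemialgebraicFunOn_ratCast hEsa 0) hf_on hf_off
    rwa [union_sdiff_cancel hr_sub] at h
  have hf_int : IntegrableOn f B :=
    ((integrable_indicator_iff hrm).2 r.integrableOn).integrableOn
  let R : KZ.IntegralRep 1 := ⟨B, f, hBsa, hf_sa, hf_int⟩
  -- the two pieces `R_M = [B, M]`, `R_g = [B, f - M]`
  let RM : KZ.IntegralRep 1 := ⟨B, M, hBsa, hM_sa, hM_int⟩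
  let Rg : KZ.IntegralRep 1 := ⟨B, fun z => f z - M z, hBsa, hf_sa.fun_sub hM_sa, hf_int.sub hM_int⟩
  -- the base representation `[pt, 0]`
  let r' : KZ.IntegralRep 0 :=
    ⟨univ, fun _ => 0, hτ, by simpa using isSemialgebraicFunOn_ratCast hτ 0, integrableOn_zero⟩
  have h0 : KZ.of r' ∈ KZ.relations := KZ.of_mem_relations_of_eqOn_zero r' fun _ _ => rfl
  -- fibre membership
  have hmem_snoc : ∀ (x : Fin 0 → ℝ), ∀ t ∈ Ioo (0 : ℝ) 1, (Fin.snoc x t : Fin 1 → ℝ) ∈ r.domain :=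
    fun x t ht => (hmemr _).2 (by simpa only [snoc_fin_one_apply_zero] using ht)
  -- (1) integrand additivity on the closed band: `[B, f] = [B, f - M] + [B, M]`
  have hsplit : KZ.of R - KZ.of Rg - KZ.of RM ∈ KZ.relations :=
    KZ.integrandAddRel_subset_relations ⟨1, R, Rg, RM, rfl, rfl, fun z _ => by
      show f z = (f z - M z) + M z
      rw [sub_add_cancel], rfl⟩
  -- (2) the exact part: one Newton–Leibniz move over the point with the primitive `G`
  have keyg : KZ.of Rg - KZ.of r' ∈ KZ.relations := by
    refine KZ.newtonLeibnizRel_subset_relations ⟨0, Rg, r', fun _ => (0 : ℝ), fun _ => 1,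
      fun z => G (z 0), ?_, ha, hb, fun _ _ => zero_le_one, rfl, fun x _ => ?_,
      fun x _ t ht => ?_, fun x _ => ?_, rfl⟩
    · -- the primitive is semialgebraic on the closed band
      show IsSemialgebraicFunOn ℚ B (fun z : Fin 1 → ℝ => G (z 0))
      rw [hB]
      exact hGsa
    · -- continuity on the closed fibre
      show ContinuousOn (fun t : ℝ => G ((Fin.snoc x t : Fin 1 → ℝ) 0)) (Icc 0 1)
      simpa only [snoc_fin_one_apply_zero] using hGc
    · -- derivative on the open fibre: `G′ = g = f - M` there
      have hmem := hmem_snoc x t ht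
      show HasDerivAt (fun s : ℝ => G ((Fin.snoc x s : Fin 1 → ℝ) 0))
        (f (Fin.snoc x t) - M (Fin.snoc x t)) t
      rw [hf_on hmem, hint hmem]
      simp only [hM_def, snoc_fin_one_apply_zero, add_sub_cancel_right]
      exact hGd t ht
    · -- the base integrand is `G 1 - G 0 = 0`
      show (0 : ℝ) = G ((Fin.snoc x 1 : Fin 1 → ℝ) 0) - G ((Fin.snoc x 0 : Fin 1 → ℝ) 0)
      simp only [snoc_fin_one_apply_zero, hG10, sub_self]
  -- (3) the modulus part: the proved logarithmic Newton–Leibniz rule, `n = 0`, `k = m`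
  have hterm_int : ∀ i, IntegrableOn
      (fun z : Fin 1 → ℝ => h i * (2 * (z 0 - a i)) / ((z 0 - a i) ^ 2 + (b i) ^ 2)) B := fun i =>
    (hterm_c i).integrableOn_compact hBc
  have keyM : KZ.of RM - KZ.of r' ∈ KZ.relations := by
    refine Summit.KontsevichZagierPeriods.LiouvilleUnfolding.LogPrimitiveNL.LogPrimitiveNL_of 0 m RM r'
      (fun _ => (0 : ℝ)) (fun _ => 1) (fun i _ => h i) (fun i z => (z 0 - a i) ^ 2 + (b i) ^ 2)
      (fun i z => 2 * (z 0 - a i)) ha hb (fun _ _ => zero_le_one) rfl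
      (fun i => isSemialgebraicFunOn_const_of_isAlgebraic hτ (halg i).2.2) (fun i => hVsa i)
      (fun i z hz => hVpos i z hz) (fun i x _ => ?_) (fun i x _ t _ => ?_) (fun i => hterm_int i)
      (fun x _ t _ => ?_) (fun x _ => ?_)
    · -- continuity of `V i` on the closed fibre
      show ContinuousOn (fun t : ℝ => ((Fin.snoc x t : Fin 1 → ℝ) 0 - a i) ^ 2 + (b i) ^ 2) (Icc 0 1)
      simp only [snoc_fin_one_apply_zero]
      fun_prop
    · -- derivative of `V i` on the open fibre
      show HasDerivAt (fun s : ℝ => ((Fin.snoc x s : Fin 1 → ℝ) 0 - a i) ^ 2 + (b i) ^ 2)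
        (2 * ((Fin.snoc x t : Fin 1 → ℝ) 0 - a i)) t
      simp only [snoc_fin_one_apply_zero]
      have hd := (((hasDerivAt_id' t).sub_const (a i)).fun_pow 2).add_const ((b i) ^ 2)
      refine hd.congr_deriv ?_
      norm_num
    · -- the band integrand on the open fibre is `Σ hᵢ Vᵢ′/Vᵢ`
      rfl
    · -- the base integrand is `Σ hᵢ (log Vᵢ 1 − log Vᵢ 0) = 0`
      show (0 : ℝ) = _
      simp only [snoc_fin_one_apply_zero]
      refine (Eq.trans (Finset.sum_congr rfl fun i _ => ?_) hmod).symm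
      have h1 : (1 - a i) ^ 2 + (b i) ^ 2 ≠ 0 := hV i 1 ⟨zero_le_one, le_rfl⟩
      have h0' : (0 - a i) ^ 2 + (b i) ^ 2 ≠ 0 := hV i 0 ⟨le_rfl, zero_le_one⟩
      rw [zero_sub, neg_sq] at h0' ⊢
      rw [Real.log_div h1 h0']
  -- (4) closing the endpoints: `[B, f] = [r] + [B ∖ (0,1), f]`, the latter over a null domain
  let r₂ : KZ.IntegralRep 1 := R.restrict (B \ r.domain) hEsa sdiff_subset
  have h1 : KZ.of R - KZ.of r - KZ.of r₂ ∈ KZ.relations :=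
    KZ.domainAddRel_subset_relations ⟨1, R, r, r₂, (union_sdiff_cancel hr_sub).symm, by
      show volume (r.domain ∩ (B \ r.domain)) = 0
      rw [inter_sdiff_self, measure_empty], hf_on, fun _ _ => rfl, rfl⟩
  have h2 : KZ.of r₂ ∈ KZ.relations := KZ.of_mem_relations_of_volume_eq_zero r₂ hnull
  have hR : KZ.of R ∈ KZ.relations := by
    have e : KZ.of R = (KZ.of R - KZ.of Rg - KZ.of RM) + ((KZ.of Rg - KZ.of r') + KZ.of r') +
        ((KZ.of RM - KZ.of r') + KZ.of r') := by
      abel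
    rw [e]
    exact KZ.relations.add_mem (KZ.relations.add_mem hsplit (KZ.relations.add_mem keyg h0))
      (KZ.relations.add_mem keyM h0)
  have hsum : KZ.of r = KZ.of R - (KZ.of R - KZ.of r - KZ.of r₂) - KZ.of r₂ := by abel
  rw [hsum]
  exact KZ.relations.sub_mem (KZ.relations.sub_mem hR h1) h2

end Summit.KontsevichZagierPeriods.InverseLandau

end
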